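import Summits.AtomisticToContinuum.FouriersLaw.Theorems.BondHeatUncertaintyExtensiveSnapshotIrreversibilityEnergyWindowEnergyBudget
import HarnessLib

/-!
# Bond heat uncertainty — energy window: PATH-SIDE moments are paid by the budget
  (rung (C2d) beneath the open leaf (COF))

Cell `decomp-a2c`, lens-1 «grading / quantitative ladder», generation 84, crux
`stmt-AtomisticToContinuum-9121` (`ExtensiveSnapshotIrreversibility`, K_fix half, leaf S3), part O
(imports part I-A `…EnergyWindowEnergyBudget` + HarnessLib).  In the site-transfer proof of
(COF) planned in memo NODE-g84 §5 every PATH-dependent coefficient (Hessian entries `∂²Φ(q_r)`,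
their time derivatives, powers of the energy) enters only through a TIME INTEGRAL over a
sub-window `[a, b] ⊆ [0, 1]`, never through a `sup` (a `sup` of the energy is not budget
currency — the pre-registered kill criterion of (COF)).  This file proves that all such
integrals are LINEAR in the budget `Θ_θ = ∫₀¹ exp(θ H(ζ_u)) du`, for every `θ > 0`:

* `pow_le_factorial_div_pow_mul_exp` — pointwise, `y^k ≤ (k!/θ^k) exp(θ y)` for `y ≥ 0`;
* `intervalIntegral_pathEnergy_pow_le` — `∫ₐᵇ H(ζ_u)^k du ≤ (k!/θ^k) Θ_θ` for
  `0 ≤ a ≤ b ≤ 1`, every `k : ℕ`;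
* `hessPotential_sq_le` — pointwise, `Hess_{ij}(q)² ≤ 2a₀² + 2b₀² H(q, p)` with the constants
  `a₀ = ω₂ + N²`, `b₀ = 6√lam + 6N²√β` of the tree's `abs_hessPotential_le`;
* `intervalIntegral_hessPotential_sq_le` — `∫ₐᵇ Hess_{ij}(q_u)² du ≤ (2a₀² + 2b₀²/θ) Θ_θ` along
  every driven path, for `0 ≤ a ≤ b ≤ 1`.

So the `L²([a, b])` norms of the costate-equation coefficients — the constants `M` fed to the
interpolation inequalities of part N (`…EnergyWindowInterpolation`) — are `O_θ(Θ_θ^{1/2})`.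
(The time DERIVATIVE of `Hess(q_r)` needs `q̇ = p` along the path and the third derivatives of
the potentials; that is rung (C2e), left to g85 — see memo NODE-g84 §5.)

References: tree `…EnergyWindowFlowJacobian` (`abs_hessPotential_le`), tree
`LangevinChainKernelDensity` (`continuous_hessPotential_pinned`), part I-A (`pathEnergy`,
`energyBudget`, `one_le_energyBudget`).
-/

namespace Summit.AtomisticToContinuum.FouriersLaw.Theorems.ExtensiveSnapshotIrreversibility.EnergyWindow

open MeasureTheory Set
open scoped Nat
open Literature.MathematicalPhysics.KineticTheory.HeatConduction Literature.Probability.Process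

/-! ## 1. Polynomials are paid by the exponential (pointwise) -/

/-- For `y ≥ 0`, `θ > 0` and `k : ℕ`: `y^k ≤ (k!/θ^k) · exp(θ y)`. [folklore] -/
theorem pow_le_factorial_div_pow_mul_exp {y θ : ℝ} (hy : 0 ≤ y) (hθ : 0 < θ) (k : ℕ) :
    y ^ k ≤ (k ! : ℝ) / θ ^ k * Real.exp (θ * y) := by
  have h := Real.pow_div_factorial_le_exp (θ * y) (mul_nonneg hθ.le hy) k
  have hk : (0 : ℝ) < k ! := by positivity
  have hθk : 0 < θ ^ k := pow_pos hθ k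
  rw [div_le_iff₀ hk, mul_pow] at h
  rw [div_mul_eq_mul_div, le_div_iff₀ hθk]
  calc y ^ k * θ ^ k = θ ^ k * y ^ k := mul_comm _ _
    _ ≤ Real.exp (θ * y) * k ! := h
    _ = (k ! : ℝ) * Real.exp (θ * y) := mul_comm _ _

/-! ## 2. Path-energy moments on sub-windows -/

section Path

variable {ω₂ lam β γ : ℝ} (hω : 0 < ω₂) (hl : 0 ≤ lam) (hβ : 0 ≤ β) (hγ : 0 ≤ γ) (N : ℕ)
  {T_L T_R : ℝ}

include hω hl hβ hγ in
/-- **Path-energy moments are paid by the budget**: for `θ > 0`, `k : ℕ` and a sub-window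
`0 ≤ a ≤ b ≤ 1`, `∫ₐᵇ H(ζ_u)^k du ≤ (k!/θ^k) · Θ_θ`. [NEW · rung (C2d) beneath (COF)] -/
theorem intervalIntegral_pathEnergy_pow_le {θ : ℝ} (hθ : 0 < θ) (k : ℕ) (z : PhaseSpace N)
    (wp : WienerPair) {a b : ℝ} (h0a : 0 ≤ a) (hab : a ≤ b) (hb1 : b ≤ 1) :
    ∫ u in a..b, pathEnergy ω₂ lam β γ N T_L T_R z wp u ^ k ≤
      (k ! : ℝ) / θ ^ k * energyBudget ω₂ lam β γ N T_L T_R θ z wp := by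
  set Hp := pathEnergy ω₂ lam β γ N T_L T_R z wp with hHp
  have hHc : Continuous Hp := continuous_pathEnergy hω hl hβ hγ z wp
  have hH0 : ∀ u, 0 ≤ Hp u := pathEnergy_nonneg hω.le hl hβ z wp
  have hEc : Continuous fun u => Real.exp (θ * Hp u) :=
    continuous_exp_mul_pathEnergy hω hl hβ hγ θ z wp
  have hC0 : 0 ≤ (k ! : ℝ) / θ ^ k := by positivity
  calc ∫ u in a..b, Hp u ^ k ≤ ∫ u in a..b, (k ! : ℝ) / θ ^ k * Real.exp (θ * Hp u) :=
        intervalIntegral.integral_mono_on hab ((hHc.pow k).intervalIntegrable _ _)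
          ((continuous_const.mul hEc).intervalIntegrable _ _)
          fun u _ => pow_le_factorial_div_pow_mul_exp (hH0 u) hθ k
    _ = (k ! : ℝ) / θ ^ k * ∫ u in a..b, Real.exp (θ * Hp u) :=
        intervalIntegral.integral_const_mul _ _
    _ ≤ (k ! : ℝ) / θ ^ k * energyBudget ω₂ lam β γ N T_L T_R θ z wp := by
        refine mul_le_mul_of_nonneg_left ?_ hC0
        unfold energyBudget
        exact intervalIntegral.integral_mono_interval h0a hab hb1
          (Filter.Eventually.of_forall fun u => (Real.exp_pos _).le) (hEc.intervalIntegrable _ _)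

include hω hl hβ hγ in
/-- The first moment: `∫ₐᵇ H(ζ_u) du ≤ Θ_θ / θ` on every sub-window of `[0, 1]`. [folklore] -/
theorem intervalIntegral_pathEnergy_le {θ : ℝ} (hθ : 0 < θ) (z : PhaseSpace N)
    (wp : WienerPair) {a b : ℝ} (h0a : 0 ≤ a) (hab : a ≤ b) (hb1 : b ≤ 1) :
    ∫ u in a..b, pathEnergy ω₂ lam β γ N T_L T_R z wp u ≤
      1 / θ * energyBudget ω₂ lam β γ N T_L T_R θ z wp := by
  have h := intervalIntegral_pathEnergy_pow_le (T_L := T_L) (T_R := T_R) hω hl hβ hγ N hθ 1 z wp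
    h0a hab hb1
  simpa only [pow_one, Nat.factorial_one, Nat.cast_one] using h

/-! ## 3. Hessian entries along the path, in `L²` -/

include hω hl hβ in
/-- Pointwise: `Hess_{ij}(q)² ≤ 2a₀² + 2b₀² H(q, p)` with `a₀ = ω₂ + N²`,
`b₀ = 6√lam + 6N²√β`. [folklore] -/
theorem hessPotential_sq_le (x : PhaseSpace N) (i j : Fin N) :
    ((pinnedChain ω₂ lam β γ).hessPotential N i j x.1) ^ 2 ≤
      2 * (ω₂ + (N : ℝ) * N) ^ 2 + 2 * (6 * √lam + (N : ℝ) * N * (6 * √β)) ^ 2 *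
        (pinnedChain ω₂ lam β γ).hamiltonian N x := by
  set H := (pinnedChain ω₂ lam β γ).hamiltonian N x with hH
  set a₀ := ω₂ + (N : ℝ) * N with ha₀
  set b₀ := 6 * √lam + (N : ℝ) * N * (6 * √β) with hb₀
  have hH0 : 0 ≤ H := pinnedChain_hamiltonian_nonneg hω.le hl hβ γ N x
  have h := abs_hessPotential_le (γ := γ) hω hl hβ N x i j
  have hsq : ((pinnedChain ω₂ lam β γ).hessPotential N i j x.1) ^ 2 ≤ (a₀ + b₀ * √H) ^ 2 := by
    have h2 := pow_le_pow_left₀ (abs_nonneg _) h 2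
    rwa [sq_abs] at h2
  have hs : √H ^ 2 = H := Real.sq_sqrt hH0
  nlinarith [hsq, hs, sq_nonneg (a₀ - b₀ * √H)]

include hω hl hβ hγ in
/-- **Hessian entries along a driven path are `O_θ(Θ_θ^{1/2})` in `L²`**: for `θ > 0` and a
sub-window `0 ≤ a ≤ b ≤ 1`, `∫ₐᵇ Hess_{ij}(q_u)² du ≤ (2a₀² + 2b₀²/θ) · Θ_θ`.
[NEW · rung (C2d) beneath (COF)] -/
theorem intervalIntegral_hessPotential_sq_le {θ : ℝ} (hθ : 0 < θ) (i j : Fin N)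
    (z : PhaseSpace N) (wp : WienerPair) {a b : ℝ} (h0a : 0 ≤ a) (hab : a ≤ b) (hb1 : b ≤ 1) :
    ∫ u in a..b, ((pinnedChain ω₂ lam β γ).hessPotential N i j
        ((pinnedChain ω₂ lam β γ).solMap N T_L T_R u z (pairPath wp)).1) ^ 2 ≤
      (2 * (ω₂ + (N : ℝ) * N) ^ 2 + 2 * (6 * √lam + (N : ℝ) * N * (6 * √β)) ^ 2 / θ) *
        energyBudget ω₂ lam β γ N T_L T_R θ z wp := by
  set P := pinnedChain ω₂ lam β γ with hP
  set a₀ := ω₂ + (N : ℝ) * N with ha₀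
  set b₀ := 6 * √lam + (N : ℝ) * N * (6 * √β) with hb₀
  set Hp := pathEnergy ω₂ lam β γ N T_L T_R z wp with hHp
  set Θ := energyBudget ω₂ lam β γ N T_L T_R θ z wp with hΘ
  have hΘ1 : 1 ≤ Θ := one_le_energyBudget hω hl hβ hγ hθ.le z wp
  have hHc : Continuous Hp := continuous_pathEnergy hω hl hβ hγ z wp
  -- pointwise bound along the path
  have hpt : ∀ u, (P.hessPotential N i j (P.solMap N T_L T_R u z (pairPath wp)).1) ^ 2 ≤
      2 * a₀ ^ 2 + 2 * b₀ ^ 2 * Hp u := fun u =>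
    hessPotential_sq_le hω hl hβ N (P.solMap N T_L T_R u z (pairPath wp)) i j
  -- continuity of the integrand
  have hcont : Continuous fun u =>
      (P.hessPotential N i j (P.solMap N T_L T_R u z (pairPath wp)).1) ^ 2 :=
    ((continuous_hessPotential_pinned (ω₂ := ω₂) (lam := lam) (β := β) (γ := γ) N i j).comp
      (continuous_fst.comp
        (pinnedChain_continuous_solMap hω hl hβ hγ N T_L T_R z (pairPath wp)))).pow 2
  have hI1 : ∫ u in a..b, Hp u ≤ 1 / θ * Θ :=
    intervalIntegral_pathEnergy_le hω hl hβ hγ N hθ z wp h0a hab hb1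
  have iC : IntervalIntegrable (fun _ : ℝ => 2 * a₀ ^ 2) volume a b := intervalIntegrable_const
  have iH : IntervalIntegrable (fun u => 2 * b₀ ^ 2 * Hp u) volume a b :=
    (continuous_const.mul hHc).intervalIntegrable _ _
  calc ∫ u in a..b, (P.hessPotential N i j (P.solMap N T_L T_R u z (pairPath wp)).1) ^ 2
      ≤ ∫ u in a..b, (2 * a₀ ^ 2 + 2 * b₀ ^ 2 * Hp u) :=
        intervalIntegral.integral_mono_on hab (hcont.intervalIntegrable _ _) (iC.add iH)
          fun u _ => hpt u
    _ = 2 * a₀ ^ 2 * (b - a) + 2 * b₀ ^ 2 * ∫ u in a..b, Hp u := by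
        rw [intervalIntegral.integral_add iC iH, intervalIntegral.integral_const,
          intervalIntegral.integral_const_mul, smul_eq_mul]
        ring
    _ ≤ 2 * a₀ ^ 2 * Θ + 2 * b₀ ^ 2 * (1 / θ * Θ) := by
        have h1 : b - a ≤ Θ := by linarith
        have h2 : 0 ≤ 2 * a₀ ^ 2 := by positivity
        have h3 : 0 ≤ 2 * b₀ ^ 2 := by positivity
        nlinarith [mul_le_mul_of_nonneg_left h1 h2, mul_le_mul_of_nonneg_left hI1 h3]
    _ = (2 * a₀ ^ 2 + 2 * b₀ ^ 2 / θ) * Θ := by ring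

end Path

end Summit.AtomisticToContinuum.FouriersLaw.Theorems.ExtensiveSnapshotIrreversibility.EnergyWindow
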